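import Mathlib
import Summits.Ventures.HodgeRepro2.T5SchurRepresentation

/-!
# Compact open subgroups of a locally compact totally disconnected group (van Dantzig), and the
# countable basis of open compact subgroups behind «admissible ⇒ countable dimension»

Blind cell `pub-hodge-repro2`, seat p8 (gen 5), Tier-5 kernel support.  `T5SchurRepresentation`
(p392116) proves Schur's lemma for a smooth admissible irreducible representation from a
COUNTABLE FAMILY of open subgroups `K i` that is a basis of the open subgroups (every open
subgroup contains some `K i`) — «the countable basis of open compact subgroups of a p-adic
group», left as prose there.  This file discharges it from the topology of the group:

* **van Dantzig, locally compact form.** Mathlib proves (`IsTopologicalGroup.exist_openSubgroup_sub_clopen_nhds_of_one`)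
  that in a COMPACT group every clopen neighbourhood of `1` contains an open subgroup; its
  proof uses compactness only through the compactness of the neighbourhood.  We re-run it for a
  COMPACT OPEN neighbourhood `W` of `1` in an arbitrary topological group
  (`exist_openSubgroup_sub_compact_open_nhds_of_one`), obtaining an open subgroup `H ⊆ W`,
  which is then compact (closed in `W`).
* In a locally compact Hausdorff totally disconnected group every neighbourhood of `1` contains
  a compact open subgroup (`exists_compact_openSubgroup_subset`; Mathlib's clopen basis
  `loc_compact_Haus_tot_disc_of_zero_dim`).
* With a countable neighbourhood basis of `1` (`FirstCountableTopology`), a countable family of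
  compact open subgroups `K n` below which every open subgroup lies
  (`exists_countable_basis_compact_openSubgroup`).
* **Schur for p-adic groups**: `exists_smul_eq_of_smooth_admissible_padic` — an irreducible
  smooth representation of a first-countable locally compact totally disconnected Hausdorff
  group with finite-dimensional invariants under every compact open subgroup (admissibility)
  has only scalar equivariant endomorphisms over an uncountable algebraically closed field;
  `…_complex` instance.

What stays prose: that the groups of the record (`U(V)(F_v)` etc.) are first-countable locally
compact totally disconnected Hausdorff groups, and admissibility of the representations.

README §8(d): uses an L-value-free non-vanishing device: NO.
-/

namespace Summit.Ventures.HodgeRepro2.T5VanDantzig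

open scoped Pointwise
open Set Filter Topology

section VanDantzig

variable {G : Type*} [TopologicalSpace G] [Group G] [IsTopologicalGroup G]

/-- For a compact open `W`, there is a neighbourhood `T` of `1` with `W * T ⊆ W`
(Mathlib's `IsTopologicalGroup.exist_mul_closure_nhds` with «`G` compact, `W` clopen» replaced by
«`W` compact open»). -/
theorem exist_mul_closure_nhds_of_isCompact {W : Set G} (WCompact : IsCompact W)
    (WOpen : IsOpen W) : ∃ T ∈ 𝓝 (1 : G), W * T ⊆ W := by
  apply WCompact.induction_on (p := fun S ↦ ∃ T ∈ 𝓝 (1 : G), S * T ⊆ W)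
    ⟨Set.univ, by simp only [univ_mem, empty_mul, empty_subset, and_self]⟩
    (fun _ _ huv ⟨T, hT, mem⟩ ↦ ⟨T, hT, (mul_subset_mul_right huv).trans mem⟩)
    fun U V ⟨T₁, hT₁, mem1⟩ ⟨T₂, hT₂, mem2⟩ ↦ ⟨T₁ ∩ T₂, inter_mem hT₁ hT₂, by
      rw [union_mul]
      exact union_subset (mul_subset_mul_left inter_subset_left |>.trans mem1)
        (mul_subset_mul_left inter_subset_right |>.trans mem2)⟩
  intro x memW
  have : (x, 1) ∈ (fun p ↦ p.1 * p.2) ⁻¹' W := by simp [memW]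
  rcases isOpen_prod_iff.mp (continuous_mul.isOpen_preimage W WOpen) x 1 this with
    ⟨U, V, Uopen, Vopen, xmemU, onememV, prodsub⟩
  have h6 : U * V ⊆ W := mul_subset_iff.mpr (fun _ hx _ hy ↦ prodsub (mk_mem_prod hx hy))
  exact ⟨U ∩ W, ⟨U, Uopen.mem_nhds xmemU, W, fun _ a ↦ a, rfl⟩,
    V, IsOpen.mem_nhds Vopen onememV, fun _ a ↦ h6 ((mul_subset_mul_right inter_subset_left) a)⟩

/-- For a compact open `W`, an open symmetric neighbourhood `T` of `1` with `W * T ⊆ W`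
(Mathlib's `mulInvClosureNhd` structure). -/
theorem exists_mulInvClosureNhd_of_isCompact {W : Set G} (WCompact : IsCompact W)
    (WOpen : IsOpen W) : ∃ T, IsTopologicalGroup.mulInvClosureNhd T W := by
  rcases exist_mul_closure_nhds_of_isCompact WCompact WOpen with ⟨S, Smemnhds, mulclose⟩
  rcases mem_nhds_iff.mp Smemnhds with ⟨U, UsubS, Uopen, onememU⟩
  refine ⟨U ∩ U⁻¹, ?_, ?_, ?_, ?_⟩
  · simp [Uopen.mem_nhds onememU, inv_mem_nhds_one]
  · simp [inter_comm]
  · exact Uopen.inter Uopen.inv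
  · exact fun a ha ↦ mulclose (mul_subset_mul_left UsubS (mul_subset_mul_left inter_subset_left ha))

/-- **Van Dantzig, local form.** A compact open neighbourhood `W` of `1` contains an open
subgroup (Mathlib's `exist_openSubgroup_sub_clopen_nhds_of_one` without `CompactSpace G`). -/
theorem exist_openSubgroup_sub_compact_open_nhds_of_one {W : Set G} (WCompact : IsCompact W)
    (WOpen : IsOpen W) (einW : 1 ∈ W) : ∃ H : OpenSubgroup G, (H : Set G) ⊆ W := by
  rcases exists_mulInvClosureNhd_of_isCompact WCompact WOpen with ⟨V, hV⟩
  let S : Subgroup G := {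
    carrier := ⋃ n, V ^ (n + 1)
    mul_mem' := fun ha hb ↦ by
      rcases mem_iUnion.mp ha with ⟨k, hk⟩
      rcases mem_iUnion.mp hb with ⟨l, hl⟩
      apply mem_iUnion.mpr
      use k + 1 + l
      rw [add_assoc, pow_add]
      exact Set.mul_mem_mul hk hl
    one_mem' := by
      apply mem_iUnion.mpr
      use 0
      simp [mem_of_mem_nhds hV.nhds]
    inv_mem' := fun ha ↦ by
      rcases mem_iUnion.mp ha with ⟨k, hk⟩
      apply mem_iUnion.mpr
      use k
      rw [← hV.inv]
      simpa only [inv_pow, Set.mem_inv, inv_inv] using hk }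
  have : IsOpen (⋃ n, V ^ (n + 1)) := by
    refine isOpen_iUnion (fun n ↦ ?_)
    rw [pow_succ]
    exact hV.isOpen.mul_left
  use ⟨S, this⟩
  have mulVpow (n : ℕ) : W * V ^ (n + 1) ⊆ W := by
    induction n with
    | zero => simp [hV.mul]
    | succ n ih =>
      rw [pow_succ, ← mul_assoc]
      exact (Set.mul_subset_mul_right ih).trans hV.mul
  have (n : ℕ) : V ^ (n + 1) ⊆ W * V ^ (n + 1) := by
    intro x xin
    rw [Set.mem_mul]
    use 1, einW, x, xin
    rw [one_mul]
  apply iUnion_subset fun i _ a ↦ mulVpow i (this i a)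

/-- **Van Dantzig.** In a locally compact Hausdorff totally disconnected group, every
neighbourhood of `1` contains a compact open subgroup. -/
theorem exists_compact_openSubgroup_subset [LocallyCompactSpace G] [T2Space G]
    [TotallyDisconnectedSpace G] {U : Set G} (hU : U ∈ 𝓝 (1 : G)) :
    ∃ H : OpenSubgroup G, IsCompact (H : Set G) ∧ (H : Set G) ⊆ U := by
  rcases mem_nhds_iff.mp hU with ⟨U', hU'U, hU'open, one_mem⟩
  obtain ⟨K, hK, hmem, hKU⟩ := exists_compact_subset hU'open one_mem
  obtain ⟨s, hs, hs1, hsK⟩ := loc_compact_Haus_tot_disc_of_zero_dim.exists_subset_of_mem_open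
    hmem isOpen_interior
  have hsClopen : IsClopen s := hs
  have hsCompact : IsCompact s :=
    hK.of_isClosed_subset hsClopen.1 (hsK.trans interior_subset)
  obtain ⟨H, hHs⟩ := exist_openSubgroup_sub_compact_open_nhds_of_one hsCompact hsClopen.2 hs1
  refine ⟨H, hsCompact.of_isClosed_subset H.isClosed hHs, ?_⟩
  exact hHs.trans ((hsK.trans interior_subset).trans (hKU.trans hU'U))

/-- **A countable basis of compact open subgroups.** In a first-countable locally compact
Hausdorff totally disconnected group there is a sequence `K n` of compact open subgroups such
that every open subgroup contains some `K n`. -/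
theorem exists_countable_basis_compact_openSubgroup [LocallyCompactSpace G] [T2Space G]
    [TotallyDisconnectedSpace G] [FirstCountableTopology G] :
    ∃ K : ℕ → OpenSubgroup G, (∀ n, IsCompact (K n : Set G)) ∧
      ∀ U : Subgroup G, IsOpen (U : Set G) → ∃ n, (K n).toSubgroup ≤ U := by
  obtain ⟨x, hx⟩ := (𝓝 (1 : G)).exists_antitone_basis
  have hmem : ∀ n, x n ∈ 𝓝 (1 : G) := fun n => hx.1.mem_of_mem trivial
  choose K hKc hKx using fun n => exists_compact_openSubgroup_subset (hmem n)
  refine ⟨K, hKc, fun U hU => ?_⟩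
  have hUn : (U : Set G) ∈ 𝓝 (1 : G) := hU.mem_nhds U.one_mem
  obtain ⟨n, -, hn⟩ := hx.1.mem_iff.mp hUn
  exact ⟨n, fun g hg => hn (hKx n hg)⟩

end VanDantzig

section Schur

open Summit.Ventures.HodgeRepro2.LevelPositivity
open Summit.Ventures.HodgeRepro2.T5SchurRepresentation
open Summit.Ventures.HodgeRepro2.T5DixmierSchur
open Cardinal

variable {G : Type*} [TopologicalSpace G] [Group G] [IsTopologicalGroup G] [LocallyCompactSpace G]
  [T2Space G] [TotallyDisconnectedSpace G] [FirstCountableTopology G]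
  {k V : Type*} [Field k] [AddCommGroup V] [Module k V] (ρ : Representation k G V)

/-- **Admissible smooth representations of p-adic groups have countable dimension.** -/
theorem rank_le_aleph0_of_admissible (hρ : IsSmooth ρ)
    (hadm : ∀ K : Subgroup G, IsOpen (K : Set G) → IsCompact (K : Set G) →
      FiniteDimensional k (invariants ρ K)) : Module.rank k V ≤ ℵ₀ := by
  obtain ⟨K, hKc, hbasis⟩ := exists_countable_basis_compact_openSubgroup (G := G)
  haveI : ∀ n, FiniteDimensional k (invariants ρ (K n).toSubgroup) :=
    fun n => hadm _ (K n).isOpen (hKc n)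
  exact rank_le_aleph0_of_finiteDimensional_invariants ρ hρ (fun n => (K n).toSubgroup) hbasis

/-- **Schur for p-adic groups.** Over an uncountable algebraically closed field, every equivariant
endomorphism of an irreducible smooth admissible representation of a first-countable locally
compact totally disconnected Hausdorff group is a scalar. -/
theorem exists_smul_eq_of_smooth_admissible_padic [IsAlgClosed k] (hk : ℵ₀ < #k)
    [IsSimpleModule (MonoidAlgebra k G) ρ.asModule] (hρ : IsSmooth ρ)
    (hadm : ∀ K : Subgroup G, IsOpen (K : Set G) → IsCompact (K : Set G) →
      FiniteDimensional k (invariants ρ K))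
    (f : V →ₗ[k] V) (hf : ∀ g v, f (ρ g v) = ρ g (f v)) : ∃ c : k, ∀ v, f v = c • v :=
  exists_smul_eq_of_equivariant ρ hk (rank_le_aleph0_of_admissible ρ hρ hadm) f hf

/-- The central character of an irreducible smooth admissible representation of a p-adic group
exists (`T5SchurRepresentation.centralCharacter`). -/
theorem exists_smul_eq_of_mem_center_padic [IsAlgClosed k] (hk : ℵ₀ < #k)
    [IsSimpleModule (MonoidAlgebra k G) ρ.asModule] (hρ : IsSmooth ρ)
    (hadm : ∀ K : Subgroup G, IsOpen (K : Set G) → IsCompact (K : Set G) →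
      FiniteDimensional k (invariants ρ K)) {z : G} (hz : z ∈ Subgroup.center G) :
    ∃ c : k, ∀ v, ρ z v = c • v :=
  exists_smul_eq_of_mem_center ρ hk (rank_le_aleph0_of_admissible ρ hρ hadm) hz

end Schur

section Complex

open Summit.Ventures.HodgeRepro2.LevelPositivity
open Summit.Ventures.HodgeRepro2.T5DixmierSchur

variable {G : Type*} [TopologicalSpace G] [Group G] [IsTopologicalGroup G] [LocallyCompactSpace G]
  [T2Space G] [TotallyDisconnectedSpace G] [FirstCountableTopology G]
  {V : Type*} [AddCommGroup V] [Module ℂ V] (ρ : Representation ℂ G V)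

/-- **Schur for p-adic groups over `ℂ`.** -/
theorem exists_smul_eq_of_smooth_admissible_padic_complex
    [IsSimpleModule (MonoidAlgebra ℂ G) ρ.asModule] (hρ : IsSmooth ρ)
    (hadm : ∀ K : Subgroup G, IsOpen (K : Set G) → IsCompact (K : Set G) →
      FiniteDimensional ℂ (invariants ρ K))
    (f : V →ₗ[ℂ] V) (hf : ∀ g v, f (ρ g v) = ρ g (f v)) : ∃ c : ℂ, ∀ v, f v = c • v :=
  exists_smul_eq_of_smooth_admissible_padic ρ aleph0_lt_mk_complex hρ hadm f hf

end Complex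

end Summit.Ventures.HodgeRepro2.T5VanDantzig
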